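import Literature.AnabelianGeometry.EtaleTheta.LogDivisorModelTateTowerKummer
import Literature.AnabelianGeometry.EtaleTheta.LogDivisorTowerRootLaw

/-!
# [EtTh] Def. 3.3 (iii) v2 / ERRATUM E2 (a): the ROOT LAW HOLDS, non-degenerately, at the Kummer–Tate tower

S. Mochizuki, *The étale theta function …*, Publ. RIMS **45** (2009) [MochizukiEtTh2009], §3 Def. 3.3 (iii) pp.73–74, Prop.
3.2 (iii) p.70; ERRATUM E2 = [IUTchI] Rmk. 3.2.4 (i)(a) («for every `N ∈ ℕ_{≥1}`, `f` admits an `N`-th root over some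
tempered covering»; IUT's approach (A)) [cite: MochizukiEtTh2009, Def 3.3 (iii) p.73].

PROOF-ONLY sequel (abc-iut cell, W6 seat d058 lineage, gen 3; 0 defs besides two connected-covering CONSTRUCTORS;
abc-iut-plan C-R34 / L2-lead R520) to `LogDivisorModelTateTowerKummer.lean` (`TateTowerKummer.tower : LogDivisorTower Grp
levels`; every level the Tate skeleton, transitions `x ↦ x^{m!/n!}`).  The kernel finding F-L2t3g5-1 (p447056 / p453110 /
`bZero_eq_one_of_rootLaw_ofTower_ofGaloisAction`): over ONE `Z^log_∞` the E2 (a) root law collapses `B₀` to `1`.  Here: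
* `TateTowerKummer.quotCover H …` — the connected tempered covering `Grp/H` for an open subgroup `H ⊇ Δ_n` (countable:
  a quotient of `ℤ × ℤ^n`; open stabilisers `= H`, `Grp` commutative); `lvl_quotCover_stab_inf` — the cover
  `Y′ := Grp/(Stab(y₀) ∩ K_{n+N})` of a level-`n` covering `Y` has level EXACTLY `n + N`;
* **`TateTowerKummer.rootLaw : (DivisorMonoids.ofTower tower).RootLaw`** — E2 (a) HOLDS on the tower datum: for
  `b ∈ B₀(Y) = Hom_Γ(Y, Mero(Z_∞^{(n)}))` and `N ≥ 1`, over `Y′` (level `n + N`) the pulled-back `b` becomes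
  `b^{e}` with `e = (n+N)!/n!` divisible by `N` (`Nat.factorial_mul_factorial_dvd_factorial_add`), so
  `r := (b ∘ f)^{e/N}` is an `N`-th root AT THE LEVEL OF `Y′` — roots appear only after the ramified level change
  (Prop. 3.2 (iii) holds at every level: `TateTower.model.eq_one_of_forall_exists_pow_eq`);
* **non-degeneracy**: `TateTowerKummer.exists_bZero_not_mem_fZero` — over the connected tempered covering `Grp/Δ₀`
  (the chain `Z_∞` itself) the coordinate `U` is a NON-constant element of `B₀` — so E2 (a) and `B₀ ≠ F₀` COEXIST
  (contrast the one-level no-go); `rootLaw_and_nondegenerate`.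
HONEST FRAMING: a combinatorial consistency witness for OUR typed v2 interface (the Kummer part of `Grp` acts trivially on
the skeleton; not the formal-scheme tower); nothing here bears on [IUTchIII] Cor. 3.12; no side taken; typed ≠ proved.
-/

noncomputable section

namespace Literature.AnabelianGeometry.EtaleTheta

open CategoryTheory Opposite Function Literature.AlgebraicGeometry.Frobenioids
  Literature.AlgebraicGeometry.Frobenioids.QuasiTemperoid Literature.AnabelianGeometry.SemiGraphs LogDivisorTower

namespace TateTowerKummer

/-! ## Open subgroups: Kummer levels, stabilisers -/

/-- `K_m`: trivial first `m` Kummer coordinates (no condition on the translation). [cite: MochizukiEtTh2009, Def 3.3 (ii) p.73] -/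
def kummerLevel (m : ℕ) : Subgroup Grp where
  carrier := {g | ∀ i < m, g.2 i = 1}
  mul_mem' {a b} ha hb i hi := by rw [Prod.snd_mul, Pi.mul_apply, ha i hi, hb i hi, mul_one]
  one_mem' _ _ := rfl
  inv_mem' {a} ha i hi := by rw [Prod.snd_inv, Pi.inv_apply, ha i hi, inv_one]

/-- `Δ_m ⊆ K_m`. [cite: MochizukiEtTh2009, Def 3.3 (ii) p.73] -/
theorem closure_le_kummerLevel (m : ℕ) : closure m ≤ kummerLevel m := fun _ hg => hg.2

/-- `K_m` is open (finitely many discrete coordinates constrained). [cite: MochizukiEtTh2009, Def 3.3 (ii) p.73] -/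
theorem isOpen_kummerLevel (m : ℕ) : IsOpen (kummerLevel m : Set Grp) := by
  have h : (kummerLevel m : Set Grp) = ⋂ i ∈ Finset.range m, (fun g : Grp => g.2 i) ⁻¹' {1} := by
    ext g
    simp only [Set.mem_iInter, Set.mem_preimage, Set.mem_singleton_iff, Finset.mem_range]
    rfl
  rw [h]
  exact isOpen_biInter_finset fun i _ =>
    (isOpen_discrete _).preimage ((continuous_apply i).comp continuous_snd)

/-- `Δ_0 = K_0 ∩ {γ = 1}` is open (the translation factor is discrete). [cite: MochizukiEtTh2009, Def 3.3 (ii) p.73] -/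
theorem isOpen_closure_zero : IsOpen (closure 0 : Set Grp) := by
  have h : (closure 0 : Set Grp) = (fun g : Grp => g.1) ⁻¹' {1} := by
    ext g
    simp only [Set.mem_preimage, Set.mem_singleton_iff]
    exact ⟨fun hg => hg.1, fun hg => ⟨hg, fun i hi => absurd hi (Nat.not_lt_zero i)⟩⟩
  rw [h]
  exact (isOpen_discrete _).preimage continuous_fst

/-- The stabiliser of a point of a tempered `Grp`-set, an open subgroup. [cite: MochizukiEtTh2009, Def 3.3 (ii) p.73] -/
def stab (T : BTemp Grp) (y : T.obj.V) : Subgroup Grp where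
  carrier := {g | T.obj.ρ g y = y}
  mul_mem' {a b} ha hb := by
    change T.obj.ρ (a * b) y = y
    rw [BTempConnected.ρ_mul_apply, hb, ha]
  one_mem' := BTempConnected.ρ_one_apply T y
  inv_mem' {a} ha := by
    change T.obj.ρ a⁻¹ y = y
    conv_lhs => rw [← ha]
    exact BTempConnected.ρ_inv_apply T a y

/-- Membership in the stabiliser. [cite: MochizukiEtTh2009, Def 3.3 (ii) p.73] -/
theorem mem_stab_iff (T : BTemp Grp) (y : T.obj.V) (g : Grp) : g ∈ stab T y ↔ T.obj.ρ g y = y := Iff.rfl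

/-- Stabilisers are open. [cite: MochizukiSemiAnbd2006, §3 p.33] -/
theorem isOpen_stab (T : BTemp Grp) (y : T.obj.V) : IsOpen (stab T y : Set Grp) := T.property.2 y

/-! ## Connected tempered coverings `Grp/H` -/

/-- `Grp/H` is countable when `Δ_n ⊆ H` (a quotient of `ℤ × ℤ^n`). [cite: MochizukiSemiAnbd2006, §3 p.33] -/
theorem countable_quotient {H : Subgroup Grp} {n : ℕ} (hn : closure n ≤ H) : Countable (Grp ⧸ H) := by
  refine Function.Surjective.countable
    (f := fun p : ℤ × (Fin n → ℤ) =>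
      (((Multiplicative.ofAdd p.1, fun i => if h : i < n then Multiplicative.ofAdd (p.2 ⟨i, h⟩) else 1) : Grp) : Grp ⧸ H))
    fun q => ?_
  induction q using QuotientGroup.induction_on with
  | H g =>
    refine ⟨(Multiplicative.toAdd g.1, fun i => Multiplicative.toAdd (g.2 i)), ?_⟩
    refine QuotientGroup.eq.2 (hn ⟨?_, fun i hi => ?_⟩)
    · simp only [ofAdd_toAdd, Prod.fst_mul, Prod.fst_inv, inv_mul_cancel]
    · simp only [Prod.snd_mul, Prod.snd_inv, Pi.mul_apply, Pi.inv_apply, dif_pos hi, ofAdd_toAdd, inv_mul_cancel]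

/-- In the commutative group `Grp` the stabiliser of EVERY point of `Grp/H` is `H`. [cite: MochizukiSemiAnbd2006, §3 p.33] -/
theorem stabilizer_quotient_eq (H : Subgroup Grp) (g : Grp) :
    {k : Grp | (Action.ofMulAction Grp (Grp ⧸ H)).ρ k (g : Grp ⧸ H) = (g : Grp ⧸ H)} = (H : Set Grp) := by
  ext k
  simp only [Set.mem_setOf_eq, SetLike.mem_coe]
  rw [Action.ofMulAction_apply, MulAction.Quotient.smul_coe, smul_eq_mul]
  change ((k * g : Grp) : Grp ⧸ H) = (g : Grp ⧸ H) ↔ k ∈ H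
  rw [QuotientGroup.eq, mul_inv_rev, mul_assoc, mul_comm k⁻¹ g, ← mul_assoc, inv_mul_cancel, one_mul, inv_mem_iff]

/-- **The connected tempered covering `Grp/H`** for an open subgroup `H ⊇ Δ_n` (countable, open stabilisers, one orbit).
[cite: MochizukiFrdII2008, Ex 1.3 (ii) p.11] -/
def quotCover (H : Subgroup Grp) (hH : IsOpen (H : Set Grp)) (n : ℕ) (hn : closure n ≤ H) : ConnectedPart (BTemp Grp) :=
  ⟨⟨Action.ofMulAction Grp (Grp ⧸ H), countable_quotient hn, fun q => by
      induction q using QuotientGroup.induction_on with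
      | H g => rw [stabilizer_quotient_eq]; exact hH⟩,
    BTempConnected.isConnectedObj_of_transitive _ ((1 : Grp) : Grp ⧸ H) fun q => by
      induction q using QuotientGroup.induction_on with
      | H g => exact ⟨g, by rw [Action.ofMulAction_apply, MulAction.Quotient.smul_coe, smul_eq_mul, mul_one]⟩⟩

/-- The underlying `Grp`-set of `quotCover H`. [cite: MochizukiFrdII2008, Ex 1.3 (ii) p.11] -/
theorem gset_quotCover (H : Subgroup Grp) (hH : IsOpen (H : Set Grp)) (n : ℕ) (hn : closure n ≤ H) :
    gset (quotCover H hH n hn) = Action.ofMulAction Grp (Grp ⧸ H) := rfl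

/-- `Δ_m` fixes `Grp/H` iff `Δ_m ⊆ H`. [cite: MochizukiEtTh2009, Def 3.3 (i) p.72] -/
theorem closure_fixes_quotCover_iff (H : Subgroup Grp) (hH : IsOpen (H : Set Grp)) (n : ℕ) (hn : closure n ≤ H) (m : ℕ) :
    (∀ g ∈ closure m, ∀ y : (quotCover H hH n hn).obj.obj.V, (quotCover H hH n hn).obj.obj.ρ g y = y) ↔ closure m ≤ H := by
  constructor
  · intro h g hg
    have h1 := h g hg ((1 : Grp) : Grp ⧸ H)
    have h2 : g ∈ {k : Grp | (Action.ofMulAction Grp (Grp ⧸ H)).ρ k ((1 : Grp) : Grp ⧸ H) = ((1 : Grp) : Grp ⧸ H)} := h1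
    rwa [stabilizer_quotient_eq] at h2
  · intro h g hg q
    change (Action.ofMulAction Grp (Grp ⧸ H)).ρ g q = q
    induction q using QuotientGroup.induction_on with
    | H k =>
      have h2 : g ∈ (H : Set Grp) := h hg
      rw [← stabilizer_quotient_eq H k] at h2
      exact h2

/-- **The level of `Grp/H` is the least `m` with `Δ_m ⊆ H`.** [cite: MochizukiEtTh2009, Def 3.3 (ii) p.73] -/
theorem lvl_quotCover_eq (H : Subgroup Grp) (hH : IsOpen (H : Set Grp)) (n : ℕ) (hn : closure n ≤ H) (m : ℕ)
    (hm : closure m ≤ H) (hmin : ∀ m' < m, ¬ closure m' ≤ H) : lvl (quotCover H hH n hn) = m := by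
  refine le_antisymm (lvl_le ((closure_fixes_quotCover_iff H hH n hn m).2 hm)) ?_
  by_contra hlt
  exact hmin _ (lt_of_not_ge hlt) ((closure_fixes_quotCover_iff H hH n hn _).1 (closure_lvl_fixes _))

/-! ## The cover `Y′ = Grp/(Stab(y₀) ∩ K_m)` of a level-`n` covering has level `max n m` -/

section Cover

variable (Y : ConnectedPart (BTemp Grp)) (y₀ : Y.obj.obj.V) (m : ℕ)

/-- `Δ_{lvl Y}` is contained in every stabiliser of `Y`. [cite: MochizukiEtTh2009, Def 3.3 (i) p.72] -/
theorem closure_lvl_le_stab : closure (lvl Y) ≤ stab Y.obj y₀ := fun g hg => closure_lvl_fixes Y g hg y₀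

/-- `Δ_{max (lvl Y) m} ⊆ Stab(y₀) ∩ K_m`. [cite: MochizukiEtTh2009, Def 3.3 (i) p.72] -/
theorem closure_max_le : closure (max (lvl Y) m) ≤ stab Y.obj y₀ ⊓ kummerLevel m :=
  le_inf ((closure_antitone (le_max_left _ _)).trans (closure_lvl_le_stab Y y₀))
    ((closure_antitone (le_max_right _ _)).trans (closure_le_kummerLevel m))

/-- **The cover `Y′ := Grp/(Stab(y₀) ∩ K_m)` of `Y`** (connected, tempered). [cite: MochizukiEtTh2009, Def 3.3 (ii) p.73] -/
def cover : ConnectedPart (BTemp Grp) :=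
  quotCover (stab Y.obj y₀ ⊓ kummerLevel m) ((isOpen_stab Y.obj y₀).inter (isOpen_kummerLevel m)) _ (closure_max_le Y y₀ m)

/-- `Y′ → Y`, `[g] ↦ g·y₀` (the stabiliser of `[1]` fixes `y₀`). [cite: MochizukiFrdII2008, Ex 1.3 (ii) p.11] -/
theorem exists_coverHom : ∃ f : cover Y y₀ m ⟶ Y, (f.hom.hom.hom ((1 : Grp) : Grp ⧸ (stab Y.obj y₀ ⊓ kummerLevel m)) :
    Y.obj.obj.V) = y₀ := by
  obtain ⟨f₀, hf₀⟩ := BTempConnected.exists_hom_of_stabilizer_le (T₁ := (cover Y y₀ m).obj) (T₂ := Y.obj)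
    ((1 : Grp) : Grp ⧸ (stab Y.obj y₀ ⊓ kummerLevel m))
    (fun q => by
      induction q using QuotientGroup.induction_on with
      | H g => exact ⟨g, by
          change (Action.ofMulAction Grp (Grp ⧸ _)).ρ g _ = _
          rw [Action.ofMulAction_apply, MulAction.Quotient.smul_coe, smul_eq_mul, mul_one]⟩)
    y₀ (fun g hg => by
      have h2 : g ∈ ((stab Y.obj y₀ ⊓ kummerLevel m : Subgroup Grp) : Set Grp) := by
        rw [← stabilizer_quotient_eq _ (1 : Grp)]; exact hg
      exact h2.1)
  exact ⟨ObjectProperty.homMk f₀, hf₀⟩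

/-- **The level of the cover is `max (lvl Y) m`.** [cite: MochizukiEtTh2009, Def 3.3 (ii) p.73] -/
theorem lvl_cover (hm : lvl Y ≤ m) : lvl (cover Y y₀ m) = m := by
  have hmax : closure m ≤ stab Y.obj y₀ ⊓ kummerLevel m := by
    have h := closure_max_le Y y₀ m
    rwa [max_eq_right hm] at h
  refine lvl_quotCover_eq _ _ _ _ m hmax fun m' hm' hle => ?_
  have h := (hle ((delta_mem_closure_iff m' m').2 le_rfl)).2 m' hm'
  change Pi.mulSingle (M := fun _ : ℕ => Multiplicative ℤ) m' (Multiplicative.ofAdd (1 : ℤ)) m' = 1 at h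
  rw [Pi.mulSingle_eq_same] at h
  exact one_ne_zero (Multiplicative.ofAdd.injective h)

end Cover

/-! ## E2 (a): the root law on the tower datum -/

/-- `N ∣ (n+N)!/n!`. [cite: MochizukiEtTh2009, Def 3.3 (iii) p.73] -/
theorem dvd_e_add (n : ℕ) (N : ℕ+) : (N : ℕ) ∣ e n (n + N) := by
  have h1 : n.factorial * (N : ℕ).factorial ∣ (n + N).factorial := Nat.factorial_mul_factorial_dvd_factorial_add n N
  have h2 : (N : ℕ).factorial ∣ e n (n + N) := Nat.dvd_div_of_mul_dvd h1
  exact (Nat.dvd_factorial N.pos le_rfl).trans h2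

/-- **E2 (a) — the ROOT LAW — HOLDS on the Kummer–Tate tower datum**: every `b ∈ B₀(Y) = Hom_Γ(Y, Mero(Z_∞^{(lvl Y)}))`
acquires, for every `N ≥ 1`, an `N`-th root over the cover `Y′ = Grp/(Stab(y₀) ∩ K_{lvl Y + N})` AT THE LEVEL `lvl Y + N`
of `Y′`: there `b` pulls back to `b^{e}`, `e = (lvl Y + N)!/(lvl Y)!`, and `r := (b ∘ f)^{e/N}`.
[cite: MochizukiEtTh2009, Def 3.3 (iii) p.73] -/
theorem rootLaw : (DivisorMonoids.ofTower tower).RootLaw := by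
  rw [LogDivisorTower.rootLaw_ofTower_iff]
  intro N Y b
  obtain ⟨y₀⟩ := BTempConnected.nonempty_of_isConnectedObj Y.obj Y.property
  obtain ⟨f, -⟩ := exists_coverHom Y y₀ (lvl Y + (N : ℕ))
  have hl : levels.lvl (cover Y y₀ (lvl Y + (N : ℕ))) = lvl Y + (N : ℕ) :=
    lvl_cover Y y₀ _ (Nat.le_add_right _ _)
  obtain ⟨q, hq⟩ := dvd_e_add (lvl Y) N
  refine ⟨cover Y y₀ (lvl Y + (N : ℕ)), f,
    ⟨fun s => (b.1 (f.hom.hom.hom s)) ^ q, fun _ => trivial, fun g s => ?_⟩, ?_⟩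
  · -- equivariance of `r = (b ∘ f)^q`: `b(f(g·s))^q = b(g·f(s))^q = (g·b(f s))^q = g·(b(f s)^q)`
    have h1 := BTempConnected.hom_ρ f.hom g s
    have h2 := b.2.2 g (f.hom.hom.hom s)
    exact (congrArg (fun x => b.1 x ^ q) h1).trans ((congrArg (· ^ q) h2).trans (map_pow _ _ _).symm)
  · -- `r^N = b ∘ f` pulled back to the level of `Y′`, i.e. `= (b ∘ f)^e`
    refine Subtype.ext (funext fun s => ?_)
    change (b.1 (f.hom.hom.hom s) ^ q) ^ (N : ℕ) =
      b.1 (f.hom.hom.hom s) ^ e (levels.lvl Y) (levels.lvl (cover Y y₀ (lvl Y + (N : ℕ))))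
    rw [hl, ← pow_mul, mul_comm, ← hq]
    rfl

/-! ## Non-degeneracy: E2 (a) and `B₀ ≠ F₀` coexist -/

/-- **The chain `Z_∞` itself as a connected tempered covering**: `Grp/Δ₀` (the translation-regular covering, level `0`).
[cite: MochizukiEtTh2009, Def 3.3 (ii) p.73] -/
def chainCover : ConnectedPart (BTemp Grp) := quotCover (closure 0) isOpen_closure_zero 0 le_rfl

/-- **`B₀ ≠ F₀` over the chain**: the Tate coordinate `U` (`g ↦ g·U = ϖ^{-t} U` on `Grp/Δ₀`) is a NON-constant element of
`B₀(Grp/Δ₀)` at its level. [cite: MochizukiEtTh2009, Def 3.3 (iii) p.73] -/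
theorem exists_bZero_not_mem_fZero :
    ∃ b : (tower.act (levels.lvl chainCover)).bZero (gset chainCover),
      b ∉ (tower.act (levels.lvl chainCover)).fZero (gset chainCover) := by
  obtain ⟨b, hb⟩ := act.exists_bZero_quotient_of_invariant (closure 0)
    (f := Multiplicative.ofAdd ((0 : ℤ), (1 : ℤ))) trivial fun h hh => by
      change LogDivisorModel.TateTower.action.actFn h.1 _ = _
      rw [hh.1, map_one, MulAut.one_apply]
  refine ⟨b, fun hF => ?_⟩
  have h1 := hF ((1 : Grp) : Grp ⧸ closure 0)
  rw [hb] at h1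
  obtain ⟨c, hc⟩ := h1
  have h2 := congrArg (fun f : Multiplicative (ℤ × ℤ) => (Multiplicative.toAdd f).2) hc
  change (0 : ℤ) = 1 at h2
  exact zero_ne_one h2

/-- **E2 (a) and non-degeneracy COEXIST on the Kummer–Tate tower** (contrast the one-level collapse
`bZero_eq_one_of_rootLaw_ofTower_ofGaloisAction`). [cite: MochizukiEtTh2009, Def 3.3 (iii) p.73] -/
theorem rootLaw_and_nondegenerate :
    (DivisorMonoids.ofTower tower).RootLaw ∧
      ∃ (Y : ConnectedPart (BTemp Grp)) (b : (tower.act (levels.lvl Y)).bZero (gset Y)),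
        b ∉ (tower.act (levels.lvl Y)).fZero (gset Y) :=
  ⟨rootLaw, chainCover, exists_bZero_not_mem_fZero⟩

end TateTowerKummer

end Literature.AnabelianGeometry.EtaleTheta

end
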